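import Literature.Geometry.Kaehler.ComplexTorusEquivariantEndomorphismAlgebraCommutantAnalyticCriterion
import Literature.Geometry.Kaehler.ComplexTorusEquivariantEndomorphismAlgebraCommutantProducts
import Literature.Geometry.Kaehler.ComplexTorusEquivariantEndomorphismAlgebraCommutantCMType
import HarnessLib

/-!
# Diagonal actions on `X₁ × X₂`: equality `End_ℚ^G(X₁ × X₂) = End_{ℚ[G]}(H₁)` holds iff both factors attain
# it WITH THE SAME SIGNS (compatible CM types); `X × X̄`-type products (`(i, -i)` on `E_i × E_i`) never do

Layer `Literature/Geometry/Kaehler`, namespace `Literature.Geometry.Kaehler.ComplexTorus`; lane `lit-hodgefound`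
(Track 2 foundations library), Layer A2, row «A2-26(dq)» (self-proposed 2026-08-27, prover seat `lit-hodgefound-p10`,
generation 23, FILE 11).  Joins generation 22's `…CommutantProducts.lean` (`prodAction`, the diagonal action
`(prodAction σ₁ σ₂) ∘ Δ`, **`endAlgRatG_diagonal_eq_centralizer_iff`**: equality iff COMMON real coefficients
`J_k = Σ_g c_g σ_k(g)`, `endAlgRatG_eq_centralizer_of_diagonal`) with generation 23's sign language: FILE 4
`…CommutantCMTypeCriterion.lean` (`complexGroupAlgebraRep`, `P_χ = ρ_ℂ(e_χ)`, `jMatrix_mul_charIdempotent_eq_I_smul_or`,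
`endAlgRatG_eq_centralizer_of_forall_exists_jMatrix_mul_eq_smul`) and FILE 8 `…CommutantAnalyticCriterion.lean`
(`asAlgebraHom_tangentRep_eq_zero_iff`, `asAlgebraHom_tangentRep_charIdempotent_star_eq_zero_iff`: the sign of `P_χ`
read on the analytic representation `ρ_a = tangentRep`).  CONSUMED BY NAME: p11's `prodPeriod`, `jMatrix_prodPeriod`;
gen-22's `ellipticPeriod`, `jMatrix_ellipticPeriod_I` (the curve `E_i`), `I_im_ne_zero`.

## The mathematics

For one finite group `G` acting on `X₁` and `X₂` (`σ_k : G → End_ℚ(X_k)`) and diagonally on `X₁ × X₂`, the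
complexified group algebra acts block-diagonally, `P_χ^{X₁×X₂} = (P_χ¹ 0; 0 P_χ²)`, and `J = (J₁ 0; 0 J₂)`.  FILE 4's
criterion "`J_ℂ P_χ = ±i P_χ` for every `χ`" for the product therefore says: **for every `χ ∈ Irr(G)` there is ONE
sign `c` with `J_{1,ℂ} P_χ¹ = c P_χ¹` AND `J_{2,ℂ} P_χ² = c P_χ²`** — both factors attain the equality (gen-22) and their
Hodge types are COMPATIBLE: no `χ` is holomorphic on `X₁` (`χ ⊂ ρ_a¹`) and antiholomorphic on `X₂` (`χ̄ ⊂ ρ_a²`).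
Analytically: `ρ_a^{X₁×X₂} = ρ_a¹ ⊕ ρ_a²` must be disjoint from its conjugate.  In particular a product of a torus with
a "conjugate" partner — same rational data, opposite complex structure (`J₂ = -J₁`), or on `E_i`: `σ₂ = σ₁ᵀ`, e.g.
`(z₁, z₂) ↦ (i z₁, -i z₂)` on `E_i × E_i` — NEVER attains the equality, although `E_i × E_i` with `(i z₁, i z₂)` does
(gen-22 `endAlgRatG_eq_centralizer_ellipticCurve_I_sq`).

## Sources, VERBATIM (held texts)

* I. Dolgachev, Yu. G. Zarhin, *Endomorphisms of Complex Abelian Varieties* (2024; held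
  `paper:galaxy-pdf-8712177384607648460`), §2.2 p0035–p0036, Remark 2.17 ("`d ≤ r²`. What will happen if the equality
  holds?") and Thm. 2.18 (second alternative: "`A` is isogenous to `B^r`, `B` of CM-type").
* H. Lange, R. E. Rodríguez, *Decomposition of Jacobians by Prym Varieties*, LNM 2310 (2022; held
  `book:lange2022-decomposition-jacobians-by-prym-varieties`), §2.2 (2.6) p0029 (`ρ_r ⊗ 1 ≃ ρ_a ⊕ \overline{ρ_a}`);
  §2.9.1 (2.26) p0042.
* H. Lange, *Abelian Varieties over the Complex Numbers* (2023), §2.4.4 Cor. 2.4.26 (proof: endomorphisms of a product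
  in blocks), §2.4.5 Exercise (10) (`E_i`, `E_ω`); Ch. Birkenhake, H. Lange, *Complex Abelian Varieties* (2004), §5.3
  (period matrix of a product), §13.3 (automorphisms and the eigenvalues of `ρ_a`).
* I. M. Isaacs, *Character Theory of Finite Groups* (1976; held), Thm. 2.12 (`e_χ`).

## What is proved (theorems only; NO definition, NO named fact, no `sorry`)

`σ_k : G →* End_ℚ(X_k)`, `Δσ = (prodAction σ₁ σ₂) ∘ (id, id)` the diagonal action on `X₁ × X₂ = prodPeriod Φ₁ Φ₂`,
`J_{k,ℂ} = (jMatrix Φ_k) ⊗ ℂ`, `P_χ^k = complexGroupAlgebraRep σ_k (charIdempotent χ)`.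
* §1 blocks: **`complexGroupAlgebraRep_diagonal`** (`Δσ_ℂ(x) = (σ_{1,ℂ}(x) 0; 0 σ_{2,ℂ}(x))`),
  `map_ofReal_jMatrix_prodPeriod`, `map_ofReal_jMatrix_prodPeriod_mul_complexGroupAlgebraRep_diagonal`.
* §2 **THE SIGN-COMPATIBILITY CRITERION `endAlgRatG_diagonal_eq_centralizer_iff_forall_exists_smul`: equality for the
  diagonal action ⟺ ∀ χ ∈ Irr(G), ∃ c, J_{1,ℂ} P_χ¹ = c P_χ¹ ∧ J_{2,ℂ} P_χ² = c P_χ²**; `eq_I_or_eq_neg_I_of_mul_eq_smul`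
  (such a `c` is `±i` once a `P ≠ 0`); **`endAlgRatG_diagonal_ne_centralizer_of_smul_of_neg_smul`** (opposite signs at one
  occurring `χ` force `End_ℚ^G ⊊ C`); the ANALYTIC form **`endAlgRatG_diagonal_eq_centralizer_iff_forall_tangentRep`**
  (⟺ ∀ χ: `ρ_a¹(e_χ) = 0 ∧ ρ_a²(e_χ) = 0`, or `ρ_a¹(e_{χ̄}) = 0 ∧ ρ_a²(e_{χ̄}) = 0`).
* §3 CONJUGATE PARTNERS (matrix level, any finite `G`): **`endAlgRatG_diagonal_ne_centralizer_of_jMatrix_eq_neg`**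
  (`J₂ = -J₁`, `σ₂ = σ₁` as matrices ⟹ strict), **`endAlgRatG_diagonal_ne_centralizer_of_transpose`** (`J₁ᵀ = -J₁`,
  `σ₂ = σ₁ᵀ` on `X × X` ⟹ strict), and the example **`endAlgRatG_ne_centralizer_ellipticCurve_I_transpose`**
  (`E_i × E_i` with `σ₂ = σ₁ᵀ`, e.g. `(i, -i)`: strict).

## References

* [DolgachevZarhin2024] I. Dolgachev, Yu. G. Zarhin, *Endomorphisms of Complex Abelian Varieties* (2024), §2.2
  Remark 2.17, Thm. 2.18.
* [LangeRodriguez2022] H. Lange, R. E. Rodríguez, *Decomposition of Jacobians by Prym Varieties*, LNM 2310 (2022),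
  §2.2 (2.6); §2.9.1 (2.26).
* [Lange2023AbelianVarietiesComplex] H. Lange, *Abelian Varieties over the Complex Numbers* (2023), §2.4.4
  Cor. 2.4.26, §2.4.5 Exercise (10).
* [BirkenhakeLange2004] Ch. Birkenhake, H. Lange, *Complex Abelian Varieties*, 2nd ed. (2004), §5.3, §13.3.
* [Isaacs1976] I. M. Isaacs, *Character Theory of Finite Groups* (1976), Thm. 2.12.
-/

noncomputable section

open Module Function
open scoped Matrix

namespace Literature.Geometry.Kaehler

namespace ComplexTorus

open Literature.RepresentationTheory.FiniteGroups

universe u v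

/-! ### §1 The diagonal action in blocks -/

section Blocks

variable {ι₁ : Type u} {ι₂ : Type v} [Fintype ι₁] [Fintype ι₂] [DecidableEq ι₁] [DecidableEq ι₂]
  {E₁ E₂ : Type*} [NormedAddCommGroup E₁] [NormedSpace ℂ E₁] [NormedAddCommGroup E₂] [NormedSpace ℂ E₂]
  {Φ₁ : (ι₁ → ℝ) ≃L[ℝ] E₁} {Φ₂ : (ι₂ → ℝ) ≃L[ℝ] E₂} {G : Type*} [Group G]
  (σ₁ : G →* endAlgRat Φ₁) (σ₂ : G →* endAlgRat Φ₂)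

/-- **`Δσ_ℂ(x) = (σ_{1,ℂ}(x) 0; 0 σ_{2,ℂ}(x))`**: the complex group algebra acts block-diagonally under the diagonal
action. [cite: Lange2023AbelianVarietiesComplex, §2.4.4 Cor. 2.4.26 (proof: `End_ℚ` of a product in blocks), p. 124] [cite: LangeRodriguez2022, §2.9.1 (2.26), p0042] -/
theorem complexGroupAlgebraRep_diagonal (x : MonoidAlgebra ℂ G) :
    complexGroupAlgebraRep ((prodAction σ₁ σ₂).comp (MonoidHom.prod (MonoidHom.id G) (MonoidHom.id G))) x =
      Matrix.fromBlocks (complexGroupAlgebraRep σ₁ x) 0 0 (complexGroupAlgebraRep σ₂ x) := by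
  induction x using MonoidAlgebra.induction_on with
  | hM g =>
    simp only [complexGroupAlgebraRep_of, MonoidHom.comp_apply, MonoidHom.prod_apply, MonoidHom.id_apply,
      coe_prodAction_apply, Matrix.fromBlocks_map, Matrix.map_zero _ (Rat.cast_zero : ((0 : ℚ) : ℂ) = 0)]
  | hadd x y hx hy =>
    rw [map_add, map_add, map_add, hx, hy, Matrix.fromBlocks_add]
    simp only [add_zero]
  | hsmul r x hx =>
    rw [map_smul, map_smul, map_smul, hx, Matrix.fromBlocks_smul]
    simp only [smul_zero]

/-- `J_ℂ` of the product: `(J₁ 0; 0 J₂) ⊗ ℂ`. [cite: BirkenhakeLange2004, §5.3 (the complex structure of a product)] -/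
theorem map_ofReal_jMatrix_prodPeriod :
    (jMatrix (prodPeriod Φ₁ Φ₂)).map ((↑) : ℝ → ℂ) =
      Matrix.fromBlocks ((jMatrix Φ₁).map ((↑) : ℝ → ℂ)) 0 0 ((jMatrix Φ₂).map ((↑) : ℝ → ℂ)) := by
  simp only [jMatrix_prodPeriod, Matrix.fromBlocks_map, Matrix.map_zero _ Complex.ofReal_zero]

/-- `J_ℂ Δσ_ℂ(x) = (J_{1,ℂ} σ_{1,ℂ}(x) 0; 0 J_{2,ℂ} σ_{2,ℂ}(x))`. [cite: Lange2023AbelianVarietiesComplex, §2.4.4 Cor. 2.4.26 (proof), p. 124] -/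
theorem map_ofReal_jMatrix_prodPeriod_mul_complexGroupAlgebraRep_diagonal (x : MonoidAlgebra ℂ G) :
    (jMatrix (prodPeriod Φ₁ Φ₂)).map ((↑) : ℝ → ℂ) *
        complexGroupAlgebraRep ((prodAction σ₁ σ₂).comp (MonoidHom.prod (MonoidHom.id G) (MonoidHom.id G))) x =
      Matrix.fromBlocks ((jMatrix Φ₁).map ((↑) : ℝ → ℂ) * complexGroupAlgebraRep σ₁ x) 0 0
        ((jMatrix Φ₂).map ((↑) : ℝ → ℂ) * complexGroupAlgebraRep σ₂ x) := by
  rw [map_ofReal_jMatrix_prodPeriod, complexGroupAlgebraRep_diagonal, Matrix.fromBlocks_multiply]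
  simp only [Matrix.zero_mul, Matrix.mul_zero, add_zero, zero_add]

end Blocks

/-! ### §2 The sign-compatibility criterion -/

section Signs

variable {ι₁ : Type u} {ι₂ : Type v} [Fintype ι₁] [Fintype ι₂] [DecidableEq ι₁] [DecidableEq ι₂]
  {E₁ E₂ : Type*} [NormedAddCommGroup E₁] [NormedSpace ℂ E₁] [NormedAddCommGroup E₂] [NormedSpace ℂ E₂]
  {Φ₁ : (ι₁ → ℝ) ≃L[ℝ] E₁} {Φ₂ : (ι₂ → ℝ) ≃L[ℝ] E₂} {G : Type} [Group G] [Fintype G]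
  (σ₁ : G →* endAlgRat Φ₁) (σ₂ : G →* endAlgRat Φ₂)

/-- **THE SIGN-COMPATIBILITY CRITERION.  `End_ℚ^G(X₁ × X₂) = End_{ℚ[G]}(H₁(X₁ × X₂, ℚ))` for the diagonal action iff
for every irreducible character `χ` ONE scalar `c` serves both factors: `J_{1,ℂ} P_χ¹ = c P_χ¹` and
`J_{2,ℂ} P_χ² = c P_χ²`** (`c = ±i` as soon as one of the blocks is non-zero: both factors attain the equality, with
the same Hodge type at every common `χ`). [cite: DolgachevZarhin2024, §2.2 Remark 2.17 and Thm. 2.18, p0035–p0036]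
[cite: Lange2023AbelianVarietiesComplex, §2.4.4 Cor. 2.4.26 (proof), p. 124] [cite: LangeRodriguez2022, §2.2 (2.6), p0029] -/
theorem endAlgRatG_diagonal_eq_centralizer_iff_forall_exists_smul :
    endAlgRatG (prodPeriod Φ₁ Φ₂) ((prodAction σ₁ σ₂).comp (MonoidHom.prod (MonoidHom.id G) (MonoidHom.id G))) =
        Subalgebra.centralizer ℚ (Set.range fun g : G ↦
          (((prodAction σ₁ σ₂).comp (MonoidHom.prod (MonoidHom.id G) (MonoidHom.id G)) g :
            endAlgRat (prodPeriod Φ₁ Φ₂)) : Matrix (ι₁ ⊕ ι₂) (ι₁ ⊕ ι₂) ℚ)) ↔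
      ∀ χ : G → ℂ, IsIrrChar G χ → ∃ c : ℂ,
        (jMatrix Φ₁).map ((↑) : ℝ → ℂ) * complexGroupAlgebraRep σ₁ (charIdempotent χ) =
            c • complexGroupAlgebraRep σ₁ (charIdempotent χ) ∧
          (jMatrix Φ₂).map ((↑) : ℝ → ℂ) * complexGroupAlgebraRep σ₂ (charIdempotent χ) =
            c • complexGroupAlgebraRep σ₂ (charIdempotent χ) := by
  constructor
  · intro h χ hχ
    rcases jMatrix_mul_charIdempotent_eq_I_smul_or _ h hχ with h1 | h1 <;>
      rw [map_ofReal_jMatrix_prodPeriod_mul_complexGroupAlgebraRep_diagonal, complexGroupAlgebraRep_diagonal,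
        Matrix.fromBlocks_smul, Matrix.fromBlocks_inj] at h1
    · exact ⟨Complex.I, h1.1, h1.2.2.2⟩
    · exact ⟨-Complex.I, h1.1, h1.2.2.2⟩
  · intro h
    refine endAlgRatG_eq_centralizer_of_forall_exists_jMatrix_mul_eq_smul _ fun χ hχ ↦ ?_
    obtain ⟨c, h1, h2⟩ := h χ hχ
    refine ⟨c, ?_⟩
    rw [map_ofReal_jMatrix_prodPeriod_mul_complexGroupAlgebraRep_diagonal, complexGroupAlgebraRep_diagonal,
      Matrix.fromBlocks_smul, h1, h2]
    simp only [smul_zero]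

omit [Fintype G] in
/-- If `J_ℂ P = c P` with `P ≠ 0` then `c = ±i` (`J_ℂ² = -1`). [cite: Lange2023AbelianVarietiesComplex, §1.1.2 Prop. 1.1.9 (the `±i`-eigenspaces of `J`)] -/
theorem eq_I_or_eq_neg_I_of_mul_eq_smul {ι : Type*} [Fintype ι] [DecidableEq ι] {E : Type*} [NormedAddCommGroup E]
    [NormedSpace ℂ E] {Φ : (ι → ℝ) ≃L[ℝ] E} {P : Matrix ι ι ℂ} {c : ℂ}
    (h : (jMatrix Φ).map ((↑) : ℝ → ℂ) * P = c • P) (hP : P ≠ 0) : c = Complex.I ∨ c = -Complex.I := by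
  have h2 : (c * c + 1) • P = 0 := by
    have h3 : (jMatrix Φ).map ((↑) : ℝ → ℂ) * ((jMatrix Φ).map ((↑) : ℝ → ℂ) * P) = -P := by
      rw [← Matrix.mul_assoc, map_ofReal_jMatrix_mul_self, Matrix.neg_mul, Matrix.one_mul]
    rw [h, Matrix.mul_smul, h, smul_smul] at h3
    rw [add_smul, one_smul, h3, neg_add_cancel]
  have hc : c * c + 1 = 0 := (smul_eq_zero.1 h2).resolve_right hP
  have hc' : (c - Complex.I) * (c + Complex.I) = 0 := by
    rw [← hc]
    ring_nf
    rw [Complex.I_sq]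
    ring
  rcases mul_eq_zero.1 hc' with h4 | h4
  · exact Or.inl (sub_eq_zero.1 h4)
  · exact Or.inr (eq_neg_of_add_eq_zero_left h4)

/-- **Opposite signs at one occurring `χ` force `End_ℚ^G(X₁ × X₂) ⊊ End_{ℚ[G]}(H₁)`** for the diagonal action:
`J_{1,ℂ} P_χ¹ = c P_χ¹ ≠ 0` and `J_{2,ℂ} P_χ² = -c P_χ² ≠ 0` (`χ` holomorphic on one factor, antiholomorphic on the other).
[cite: DolgachevZarhin2024, §2.2 Remark 2.17 (`d ≤ r²`), p0035] [cite: LangeRodriguez2022, §2.2 (2.6), p0029] -/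
theorem endAlgRatG_diagonal_ne_centralizer_of_smul_of_neg_smul {χ : G → ℂ} (hχ : IsIrrChar G χ) {c : ℂ}
    (h₁ : (jMatrix Φ₁).map ((↑) : ℝ → ℂ) * complexGroupAlgebraRep σ₁ (charIdempotent χ) =
      c • complexGroupAlgebraRep σ₁ (charIdempotent χ))
    (hP₁ : complexGroupAlgebraRep σ₁ (charIdempotent χ) ≠ 0)
    (h₂ : (jMatrix Φ₂).map ((↑) : ℝ → ℂ) * complexGroupAlgebraRep σ₂ (charIdempotent χ) =
      -(c • complexGroupAlgebraRep σ₂ (charIdempotent χ)))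
    (hP₂ : complexGroupAlgebraRep σ₂ (charIdempotent χ) ≠ 0) :
    endAlgRatG (prodPeriod Φ₁ Φ₂) ((prodAction σ₁ σ₂).comp (MonoidHom.prod (MonoidHom.id G) (MonoidHom.id G))) ≠
      Subalgebra.centralizer ℚ (Set.range fun g : G ↦
        (((prodAction σ₁ σ₂).comp (MonoidHom.prod (MonoidHom.id G) (MonoidHom.id G)) g :
          endAlgRat (prodPeriod Φ₁ Φ₂)) : Matrix (ι₁ ⊕ ι₂) (ι₁ ⊕ ι₂) ℚ)) := by
  intro h
  obtain ⟨d, hd₁, hd₂⟩ := (endAlgRatG_diagonal_eq_centralizer_iff_forall_exists_smul σ₁ σ₂).1 h χ hχ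
  -- `d = c` from the first factor, `d = -c` from the second
  have e₁ : d = c := by
    have h0 : (d - c) • complexGroupAlgebraRep σ₁ (charIdempotent χ) = 0 := by rw [sub_smul, ← hd₁, ← h₁, sub_self]
    exact sub_eq_zero.1 ((smul_eq_zero.1 h0).resolve_right hP₁)
  have e₂ : d = -c := by
    have h0 : (d + c) • complexGroupAlgebraRep σ₂ (charIdempotent χ) = 0 := by
      rw [add_smul, ← hd₂, h₂, neg_add_cancel]
    exact eq_neg_of_add_eq_zero_left ((smul_eq_zero.1 h0).resolve_right hP₂)
  -- hence `c = 0`, contradicting `c = ±i`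
  have hc : c = 0 := by
    have h3 : c + c = 0 := by rw [← sub_eq_zero.2 (e₁.symm.trans e₂), sub_neg_eq_add]
    rwa [← two_mul, mul_eq_zero, or_iff_right two_ne_zero] at h3
  rcases eq_I_or_eq_neg_I_of_mul_eq_smul h₁ hP₁ with h4 | h4
  · exact Complex.I_ne_zero (h4 ▸ hc)
  · exact Complex.I_ne_zero (neg_eq_zero.1 (h4 ▸ hc))

/-- **THE ANALYTIC FORM.  Equality for the diagonal action iff for every `χ ∈ Irr(G)`: `ρ_a¹(e_χ) = 0` and
`ρ_a²(e_χ) = 0`, or `ρ_a¹(e_{χ̄}) = 0` and `ρ_a²(e_{χ̄}) = 0`** — no irreducible `χ` occurs in `ρ_a¹ ⊕ ρ_a²` together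
with its conjugate (`ρ_a^{X₁×X₂} = ρ_a¹ ⊕ ρ_a²` and FILE 8's criterion).
[cite: LangeRodriguez2022, §2.2 (2.6), p0029] [cite: DolgachevZarhin2024, §2.2 Remark 2.17 and Thm. 2.18, p0035–p0036] -/
theorem endAlgRatG_diagonal_eq_centralizer_iff_forall_tangentRep :
    endAlgRatG (prodPeriod Φ₁ Φ₂) ((prodAction σ₁ σ₂).comp (MonoidHom.prod (MonoidHom.id G) (MonoidHom.id G))) =
        Subalgebra.centralizer ℚ (Set.range fun g : G ↦
          (((prodAction σ₁ σ₂).comp (MonoidHom.prod (MonoidHom.id G) (MonoidHom.id G)) g :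
            endAlgRat (prodPeriod Φ₁ Φ₂)) : Matrix (ι₁ ⊕ ι₂) (ι₁ ⊕ ι₂) ℚ)) ↔
      ∀ χ : G → ℂ, IsIrrChar G χ →
        ((tangentRep σ₁).asAlgebraHom (charIdempotent χ) = 0 ∧
            (tangentRep σ₂).asAlgebraHom (charIdempotent χ) = 0) ∨
          ((tangentRep σ₁).asAlgebraHom (charIdempotent (star χ)) = 0 ∧
            (tangentRep σ₂).asAlgebraHom (charIdempotent (star χ)) = 0) := by
  rw [endAlgRatG_diagonal_eq_centralizer_iff_forall_exists_smul]
  refine forall₂_congr fun χ hχ ↦ ?_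
  rw [asAlgebraHom_tangentRep_eq_zero_iff, asAlgebraHom_tangentRep_eq_zero_iff,
    asAlgebraHom_tangentRep_charIdempotent_star_eq_zero_iff, asAlgebraHom_tangentRep_charIdempotent_star_eq_zero_iff]
  constructor
  · rintro ⟨c, h1, h2⟩
    by_cases hP₁ : complexGroupAlgebraRep σ₁ (charIdempotent χ) = 0
    · by_cases hP₂ : complexGroupAlgebraRep σ₂ (charIdempotent χ) = 0
      · left
        simp only [hP₁, hP₂, Matrix.mul_zero, smul_zero, neg_zero, and_self]
      · rcases eq_I_or_eq_neg_I_of_mul_eq_smul h2 hP₂ with rfl | rfl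
        · right
          rw [hP₁, Matrix.mul_zero, smul_zero]
          exact ⟨rfl, h2⟩
        · left
          rw [hP₁, Matrix.mul_zero, smul_zero, neg_zero, h2, neg_smul]
          exact ⟨rfl, rfl⟩
    · rcases eq_I_or_eq_neg_I_of_mul_eq_smul h1 hP₁ with rfl | rfl
      · exact Or.inr ⟨h1, h2⟩
      · refine Or.inl ⟨?_, ?_⟩
        · rw [h1, neg_smul]
        · rw [h2, neg_smul]
  · rintro (⟨h1, h2⟩ | ⟨h1, h2⟩)
    · exact ⟨-Complex.I, by rw [h1, neg_smul], by rw [h2, neg_smul]⟩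
    · exact ⟨Complex.I, h1, h2⟩

end Signs

/-! ### §3 Conjugate partners: `X₁ × X₂` with `J₂ = -J₁`, and `X × X` with `σ₂ = σ₁ᵀ` -/

section Conjugate

variable {ι : Type u} [Fintype ι] [DecidableEq ι] {E₁ E₂ : Type*} [NormedAddCommGroup E₁] [NormedSpace ℂ E₁]
  [NormedAddCommGroup E₂] [NormedSpace ℂ E₂] {Φ₁ : (ι → ℝ) ≃L[ℝ] E₁} {Φ₂ : (ι → ℝ) ≃L[ℝ] E₂}
  {G : Type*} [Group G] [Fintype G] (σ₁ : G →* endAlgRat Φ₁) (σ₂ : G →* endAlgRat Φ₂)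

/-- `J ≠ 0` on a non-trivial lattice (`J² = -1`). [cite: Lange2023AbelianVarietiesComplex, §1.1.2 Prop. 1.1.6] -/
private theorem jMatrix_ne_zero_d [Nonempty ι] {E : Type*} [NormedAddCommGroup E] [NormedSpace ℂ E]
    (Φ : (ι → ℝ) ≃L[ℝ] E) : jMatrix Φ ≠ 0 := by
  intro h
  have h1 := jMatrix_mul_jMatrix (Φ := Φ)
  rw [h, Matrix.mul_zero] at h1
  exact one_ne_zero (neg_eq_zero.1 h1.symm)

/-- **`X₁ × X₂` with OPPOSITE complex structures on the same rational data never attains the equality**: if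
`J₂ = -J₁` and `σ₂(g) = σ₁(g)` as matrices for all `g` (the conjugate torus `X̄₁` with the same action), then
`End_ℚ^G(X₁ × X₂) ⊊ End_{ℚ[G]}(H₁)` for the diagonal action (common coefficients would give `J₁ = J₂ = -J₁`).
[cite: DolgachevZarhin2024, §2.2 Remark 2.17, p0035] [cite: LangeRodriguez2022, §2.2 (2.6) (`ρ_a ⊕ \overline{ρ_a}`), p0029] -/
theorem endAlgRatG_diagonal_ne_centralizer_of_jMatrix_eq_neg [Nonempty ι] (hJ : jMatrix Φ₂ = -jMatrix Φ₁)
    (hσ : ∀ g : G, ((σ₂ g : endAlgRat Φ₂) : Matrix ι ι ℚ) = ((σ₁ g : endAlgRat Φ₁) : Matrix ι ι ℚ)) :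
    endAlgRatG (prodPeriod Φ₁ Φ₂) ((prodAction σ₁ σ₂).comp (MonoidHom.prod (MonoidHom.id G) (MonoidHom.id G))) ≠
      Subalgebra.centralizer ℚ (Set.range fun g : G ↦
        (((prodAction σ₁ σ₂).comp (MonoidHom.prod (MonoidHom.id G) (MonoidHom.id G)) g :
          endAlgRat (prodPeriod Φ₁ Φ₂)) : Matrix (ι ⊕ ι) (ι ⊕ ι) ℚ)) := by
  intro h
  obtain ⟨c, hc₁, hc₂⟩ := (endAlgRatG_diagonal_eq_centralizer_iff σ₁ σ₂).1 h
  simp_rw [hσ] at hc₂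
  rw [hc₁, hJ, eq_neg_iff_add_eq_zero, ← two_smul ℝ, smul_eq_zero] at hc₂
  exact hc₂.elim (fun h2 ↦ two_ne_zero h2) (jMatrix_ne_zero_d Φ₁)

variable {E : Type*} [NormedAddCommGroup E] [NormedSpace ℂ E] {Φ : (ι → ℝ) ≃L[ℝ] E} (τ₁ τ₂ : G →* endAlgRat Φ)

/-- **`X × X` with `G` acting by `σ` on the first and by the TRANSPOSED matrices `σᵀ` on the second factor never
attains the equality when `Jᵀ = -J`** (e.g. `J` a rotation: common coefficients would give `J = (Σ c_g σ(g))ᵀ = Jᵀ = -J`).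
[cite: DolgachevZarhin2024, §2.2 Remark 2.17, p0035] [cite: BirkenhakeLange2004, §13.3 (eigenvalues of `ρ_a(σ)` and of `\overline{ρ_a}(σ)`)] -/
theorem endAlgRatG_diagonal_ne_centralizer_of_transpose [Nonempty ι] (hJ : (jMatrix Φ)ᵀ = -jMatrix Φ)
    (hτ : ∀ g : G, ((τ₂ g : endAlgRat Φ) : Matrix ι ι ℚ) = ((τ₁ g : endAlgRat Φ) : Matrix ι ι ℚ)ᵀ) :
    endAlgRatG (prodPeriod Φ Φ) ((prodAction τ₁ τ₂).comp (MonoidHom.prod (MonoidHom.id G) (MonoidHom.id G))) ≠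
      Subalgebra.centralizer ℚ (Set.range fun g : G ↦
        (((prodAction τ₁ τ₂).comp (MonoidHom.prod (MonoidHom.id G) (MonoidHom.id G)) g :
          endAlgRat (prodPeriod Φ Φ)) : Matrix (ι ⊕ ι) (ι ⊕ ι) ℚ)) := by
  intro h
  obtain ⟨c, hc₁, hc₂⟩ := (endAlgRatG_diagonal_eq_centralizer_iff τ₁ τ₂).1 h
  have ht : ∑ g, c g • ((τ₂ g : endAlgRat Φ) : Matrix ι ι ℚ).map (Rat.cast : ℚ → ℝ) =
      (∑ g, c g • ((τ₁ g : endAlgRat Φ) : Matrix ι ι ℚ).map (Rat.cast : ℚ → ℝ))ᵀ := by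
    rw [Matrix.transpose_sum]
    exact Finset.sum_congr rfl fun g _ ↦ by rw [hτ, Matrix.transpose_smul, Matrix.transpose_map]
  rw [ht, hc₁, hJ, neg_eq_iff_add_eq_zero, ← two_smul ℝ, smul_eq_zero] at hc₂
  exact hc₂.elim (fun h2 ↦ two_ne_zero h2) (jMatrix_ne_zero_d Φ)

end Conjugate

/-! ### §4 Example: `E_i × E_i` with `(z₁, z₂) ↦ (σ(g) z₁, σ(g)ᵀ z₂)`, e.g. `(i z₁, -i z₂)` -/

section Example

/-- **`E_i × E_i` with a finite group acting by `σ` on the first factor and by the transposed matrices on the second —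
e.g. `⟨g⟩ ≅ ℤ/4` through `(z₁, z₂) ↦ (i z₁, -i z₂)` (`R_iᵀ = R_i⁻¹ = R_{-i}`) — has `End_ℚ^G ⊊ End_{ℚ[G]}(H₁)`**,
in contrast with the action `(i z₁, i z₂)` (gen-22 `endAlgRatG_eq_centralizer_ellipticCurve_I_sq`: equality): the
analytic representation `θ ⊕ θ̄` meets its conjugate.  (`J_{E_i} = (0 1; -1 0)` is skew.)
[cite: DolgachevZarhin2024, §2.2 Thm. 2.18 (the eigenvalue multiplicities), p0036] [cite: Lange2023AbelianVarietiesComplex, §2.4.5 Exercise (10) (`E_i`)]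
[cite: BirkenhakeLange2004, §13.3] -/
theorem endAlgRatG_ne_centralizer_ellipticCurve_I_transpose {G : Type*} [Group G] [Fintype G]
    (τ₁ τ₂ : G →* endAlgRat (ellipticPeriod I_im_ne_zero))
    (hτ : ∀ g : G, ((τ₂ g : endAlgRat (ellipticPeriod I_im_ne_zero)) : Matrix (Fin 2) (Fin 2) ℚ) =
      ((τ₁ g : endAlgRat (ellipticPeriod I_im_ne_zero)) : Matrix (Fin 2) (Fin 2) ℚ)ᵀ) :
    endAlgRatG (prodPeriod (ellipticPeriod I_im_ne_zero) (ellipticPeriod I_im_ne_zero))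
        ((prodAction τ₁ τ₂).comp (MonoidHom.prod (MonoidHom.id G) (MonoidHom.id G))) ≠
      Subalgebra.centralizer ℚ (Set.range fun g : G ↦
        (((prodAction τ₁ τ₂).comp (MonoidHom.prod (MonoidHom.id G) (MonoidHom.id G)) g :
          endAlgRat (prodPeriod (ellipticPeriod I_im_ne_zero) (ellipticPeriod I_im_ne_zero))) :
            Matrix (Fin 2 ⊕ Fin 2) (Fin 2 ⊕ Fin 2) ℚ)) := by
  refine endAlgRatG_diagonal_ne_centralizer_of_transpose τ₁ τ₂ ?_ hτ
  have hJ : jMatrix (ellipticPeriod I_im_ne_zero) = !![0, 1; -1, 0] := jMatrix_ellipticPeriod_I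
  rw [hJ]
  ext a b
  fin_cases a <;> fin_cases b <;> simp

end Example

end ComplexTorus

end Literature.Geometry.Kaehler
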